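import Mathlib.Analysis.Normed.Module.FiniteDimension
import Mathlib.Analysis.Normed.Module.RCLike.Real
import Mathlib.LinearAlgebra.Dimension.FreeAndStrongRankCondition
import Mathlib.Topology.MetricSpace.ProperSpace
import Literature.Geometry.Riemannian.RicciFlow
import Literature.Geometry.Lorentzian.LeviCivitaProofs
import Literature.Geometry.Lorentzian.Einstein
import HarnessLib

/-!
# Ricci flow: proved complements to `RicciFlow.lean`
(topic `Geometry/Riemannian`)

This file collects results *proved* around the named fact
`Literature.Geometry.Riemannian.ricciFlow_shortTime_existence` (Hamilton 1982, Thm. 4.2;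
Topping 2006, Thm. 5.2.1) of `RicciFlow.lean`. The fact itself — short-time existence of the
Ricci flow on a closed manifold — is a short-time existence theorem for a weakly parabolic
quasilinear system (Hamilton 1982, §§4–6: symbol computation, Nash–Moser inverse function theorem,
tame estimates for weakly parabolic linear systems; or DeTurck's strictly parabolic modification,
Topping 2006, §5.2) and needs parabolic PDE theory on closed manifolds that neither Mathlib nor
this tree has; it stays a named fact. What is proved here:

* `IsContMDiffFamilyOn.continuousOn_val` — along a family of metrics that is `C^k` jointly in
  space and time on `M × S`, the bilinear form `t ↦ g_t(x)` at a fixed point is continuous on `S`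
  (the fibre inclusion of the bundle of bilinear forms is inducing).
* `IsContMDiffFamilyOn.isRiemannian_of_mem` — **the signature is constant along a continuous
  family of nondegenerate metrics**: on a preconnected time set (an interval), if one `g_{t₀}` is
  Riemannian then every `g_t` is. Pointwise linear algebra: positive definiteness is an open
  condition on a finite-dimensional space (`exists_pos_mul_norm_sq_le_of_forall_pos`,
  `forall_pos_of_norm_sub_lt`), and a limit of positive definite forms is positive semidefinite,
  hence positive definite when nondegenerate (`forall_pos_of_forall_nonneg_of_nondegenerate`);
  connectedness concludes. Consequently the conjunct "`g(t)` is Riemannian for `t ∈ [0, ε]`" of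
  `ricciFlow_shortTime_existence` is automatic:
  `ricciFlow_shortTime_existence_of_forall_exists_isRicciFlow` reduces the fact to bare existence
  of a Ricci flow `(g, cov)` on some `[0, ε]` with `g 0 = g₀`.
* `PseudoRiemannianMetric.IsRicciFlat.isRicciFlow_const` — a Ricci-flat metric is a static Ricci
  flow with its Levi-Civita connection, now unconditionally (the Levi-Civita facts are discharged
  in `Lorentzian/LeviCivitaProofs.lean`); Topping 2006, §1.2.1 (`λ = 0`).
* `ricci_eq_zero_of_finrank_le_one`, `exists_isRicciFlow_of_finrank_le_one` — in dimension `≤ 1`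
  every covariant derivative on `TM` has vanishing Ricci tensor (`R(v, v) = 0` and `T_x M` is a
  line), so the conclusion of `ricciFlow_shortTime_existence` holds there with the static flow
  (on any manifold, for all time).

## References

* R. S. Hamilton, *Three-manifolds with positive Ricci curvature*, J. Differential Geom. 17
  (1982) 255–306, §4 Thm. 4.2 (p. 262), §5 Thm. 5.1 (p. 263), §6. [Hamilton1982]
* P. Topping, *Lectures on the Ricci flow*, LMS Lecture Note Series 325 (2006), §1.2.1,
  §5.2, Thm. 5.2.1. [Topping2006]
* B. O'Neill, *Semi-Riemannian geometry* (1983), Ch. 3, p. 55 (index of a metric). [ONeill1983]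
-/

noncomputable section

open Bundle Set Filter
open scoped Manifold ContDiff Topology

namespace Literature.Geometry.Riemannian

open Lorentzian Lorentzian.PseudoRiemannianMetric

universe u v w

/-! ### Pointwise linear algebra: positive definiteness is open, and closed among nondegenerate
symmetric forms -/

section LinearAlgebra

variable {F : Type*} [NormedAddCommGroup F] [NormedSpace ℝ F]

/-- A positive definite continuous bilinear form on a finite-dimensional real normed space is
bounded below by a positive multiple of `‖v‖²` (minimum over the compact unit sphere).
[folklore] -/
theorem exists_pos_mul_norm_sq_le_of_forall_pos [FiniteDimensional ℝ F] (B : F →L[ℝ] F →L[ℝ] ℝ)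
    (hB : ∀ v, v ≠ 0 → 0 < B v v) : ∃ m : ℝ, 0 < m ∧ ∀ v, m * ‖v‖ ^ 2 ≤ B v v := by
  rcases subsingleton_or_nontrivial F with hF | hF
  · exact ⟨1, one_pos, fun v ↦ by simp [Subsingleton.elim v 0]⟩
  · have hc : IsCompact (Metric.sphere (0 : F) 1) := isCompact_sphere 0 1
    have hne : (Metric.sphere (0 : F) 1).Nonempty := NormedSpace.sphere_nonempty.2 zero_le_one
    have hcont : Continuous fun v : F ↦ B v v :=
      B.continuous₂.comp (continuous_id.prodMk continuous_id)
    obtain ⟨v₀, hv₀, hmin⟩ := hc.exists_isMinOn hne hcont.continuousOn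
    have hv₀1 : ‖v₀‖ = 1 := mem_sphere_zero_iff_norm.1 hv₀
    have hv₀' : v₀ ≠ 0 := by
      rintro rfl
      simp at hv₀1
    refine ⟨B v₀ v₀, hB v₀ hv₀', fun v ↦ ?_⟩
    by_cases hv : v = 0
    · subst hv
      simp
    · have hnv : 0 < ‖v‖ := norm_pos_iff.2 hv
      set u : F := ‖v‖⁻¹ • v with hu
      have hu1 : u ∈ Metric.sphere (0 : F) 1 := by
        rw [mem_sphere_zero_iff_norm, hu, norm_smul, norm_inv, norm_norm,
          inv_mul_cancel₀ hnv.ne']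
      have hle : B v₀ v₀ ≤ B u u := (isMinOn_iff.1 hmin) u hu1
      have hv_eq : v = ‖v‖ • u := by
        rw [hu, smul_smul, mul_inv_cancel₀ hnv.ne', one_smul]
      calc B v₀ v₀ * ‖v‖ ^ 2 ≤ B u u * ‖v‖ ^ 2 := by gcongr
        _ = B v v := by
          conv_rhs => rw [hv_eq]
          simp only [map_smul, smul_apply, smul_eq_mul]
          ring

/-- Perturbation: a form within operator-norm distance `m` of a form bounded below by `m ‖v‖²`
is positive definite. [folklore] -/
theorem forall_pos_of_norm_sub_lt {B B' : F →L[ℝ] F →L[ℝ] ℝ} {m : ℝ}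
    (hm : ∀ v, m * ‖v‖ ^ 2 ≤ B v v) (h : ‖B' - B‖ < m) (v : F) (hv : v ≠ 0) : 0 < B' v v := by
  have hnv : 0 < ‖v‖ := norm_pos_iff.2 hv
  have h1 : ‖(B' - B) v v‖ ≤ ‖B' - B‖ * ‖v‖ * ‖v‖ := (B' - B).le_opNorm₂ v v
  have h1' : |(B' - B) v v| ≤ ‖B' - B‖ * ‖v‖ * ‖v‖ := by simpa [Real.norm_eq_abs] using h1
  have h2 : -(‖B' - B‖ * ‖v‖ * ‖v‖) ≤ (B' - B) v v := (abs_le.1 h1').1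
  have h3 : (B' - B) v v = B' v v - B v v := by
    simp only [sub_apply]
  have hsq : ‖v‖ ^ 2 = ‖v‖ * ‖v‖ := sq ‖v‖
  have h4 : 0 < (m - ‖B' - B‖) * (‖v‖ * ‖v‖) := mul_pos (by linarith) (mul_pos hnv hnv)
  have h5 := hm v
  rw [hsq] at h5
  nlinarith

/-- A symmetric, nondegenerate, positive *semi*definite bilinear form is positive definite: if
`B(v, v) = 0` then `s ↦ B(v + s w, v + s w) ≥ 0` forces `B(v, w) = 0` for all `w`, so `v = 0`
(the closedness half of "the index of a continuous family of nondegenerate forms is locally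
constant", O'Neill 1983, Ch. 3, p. 55). [folklore] -/
theorem forall_pos_of_forall_nonneg_of_nondegenerate (B : F →L[ℝ] F →L[ℝ] ℝ)
    (hsymm : ∀ v w, B v w = B w v) (hnd : ∀ v, (∀ w, B v w = 0) → v = 0)
    (hpsd : ∀ v, 0 ≤ B v v) (v : F) (hv : v ≠ 0) : 0 < B v v := by
  rcases (hpsd v).lt_or_eq with h | h
  · exact h
  · exfalso
    refine hv (hnd v fun w ↦ ?_)
    by_contra hne
    have hc0 : 0 ≤ B w w := hpsd w
    have key : ∀ s : ℝ, 0 ≤ 2 * s * B v w + s ^ 2 * B w w := by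
      intro s
      have hs := hpsd (v + s • w)
      have expand : B (v + s • w) (v + s • w) = B v v + 2 * s * B v w + s ^ 2 * B w w := by
        simp only [map_add, map_smul, add_apply, smul_apply, smul_eq_mul]
        rw [hsymm w v]
        ring
      rw [expand, ← h] at hs
      linarith
    have hc1 : 0 < B w w + 1 := by linarith
    have hk := key (-B v w / (B w w + 1))
    have eq : (2 * (-B v w / (B w w + 1)) * B v w + (-B v w / (B w w + 1)) ^ 2 * B w w) *
        (B w w + 1) ^ 2 = B v w ^ 2 * (-B w w - 2) := by
      field_simp
      ring
    have hnonneg : 0 ≤ (2 * (-B v w / (B w w + 1)) * B v w + (-B v w / (B w w + 1)) ^ 2 * B w w) *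
        (B w w + 1) ^ 2 := mul_nonneg hk (sq_nonneg _)
    have ha2 : 0 < B v w ^ 2 := by positivity
    rw [eq] at hnonneg
    nlinarith

end LinearAlgebra

/-! ### Continuity in time at a fixed point, and constancy of the signature -/

section Family

variable {E : Type*} [NormedAddCommGroup E] [NormedSpace ℝ E] {H : Type*} [TopologicalSpace H]
  {I : ModelWithCorners ℝ E H} {M : Type*} [TopologicalSpace M] [ChartedSpace H M]
  [IsManifold I ∞ M] {n k : ℕ∞ω}
  {g : ℝ → PseudoRiemannianMetric I n E (TangentSpace I : M → Type _)} {S : Set ℝ}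

/-- Along a family of metrics `C^k` jointly on `M × S` (`IsContMDiffFamilyOn`, in particular
continuous into the total space of the bundle of bilinear forms), the bilinear form
`t ↦ g_t(x)` at a fixed point `x` is continuous on `S`: restrict to `{x} × S` and use that the
fibre inclusion `TotalSpace.mk x` of a fibre bundle is inducing
(`FiberBundle.totalSpaceMk_isInducing`). [folklore] -/
theorem IsContMDiffFamilyOn.continuousOn_val (h : IsContMDiffFamilyOn k g S) (x : M) :
    ContinuousOn (fun t : ℝ ↦ (g t).val x) S := by
  have h1 : ContinuousOn (fun t : ℝ ↦ TotalSpace.mk' (E →L[ℝ] E →L[ℝ] ℝ)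
      (E := fun b : M ↦ TangentSpace I b →L[ℝ] TangentSpace I b →L[ℝ] ℝ) x ((g t).val x)) S := by
    have h3 : ContinuousOn (fun t : ℝ ↦ ((x, t) : M × ℝ)) S :=
      (continuous_const.prodMk continuous_id).continuousOn
    exact h.continuousOn.comp h3 fun t ht ↦ ⟨mem_univ _, ht⟩
  exact (FiberBundle.totalSpaceMk_isInducing (F := E →L[ℝ] E →L[ℝ] ℝ)
    (E := fun b : M ↦ TangentSpace I b →L[ℝ] TangentSpace I b →L[ℝ] ℝ) x).continuousOn_iff.2 h1

-- `maxSynthPendingDepth 2`: instance search on the nested operator space `E →L[ℝ] E →L[ℝ] ℝ`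
-- (its `ContinuousSub`/uniform structure) needs one more level of nested synthesis, exactly as in
-- Mathlib's `Analysis/Normed/Operator/Bilinear.lean`.
set_option maxSynthPendingDepth 2 in
/-- **The signature is constant along a continuous family of nondegenerate metrics.** If a family
of pseudo-Riemannian metrics is `C^k` jointly on `M × S` for a preconnected time set `S` (an
interval) and `g_{t₀}` is Riemannian for some `t₀ ∈ S`, then every `g_t`, `t ∈ S`, is Riemannian:
at each point `x`, the set of times where `g_t(x)` is positive definite is open (positive
definiteness is an open condition in finite dimension) and closed (a limit of positive definite
forms is positive semidefinite, hence positive definite since every `g_t(x)` is nondegenerate) in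
`S`. This is the continuity argument behind "the index of a metric tensor is constant"
(O'Neill 1983, Ch. 3, p. 55); it makes the clause "`g(t)` is Riemannian for `t ∈ [0, ε]`" of
short-time existence automatic. [folklore] -/
theorem IsContMDiffFamilyOn.isRiemannian_of_mem [FiniteDimensional ℝ E]
    (h : IsContMDiffFamilyOn k g S) (hS : IsPreconnected S) {t₀ : ℝ} (ht₀ : t₀ ∈ S)
    (h₀ : (g t₀).IsRiemannian) : ∀ t ∈ S, (g t).IsRiemannian := by
  intro t ht x v hv
  -- the path of forms `s ↦ g_s(x)` on the model space `E` (`TangentSpace I x` is `E`)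
  haveI : PreconnectedSpace S := isPreconnected_iff_preconnectedSpace.1 hS
  let B : S → (E →L[ℝ] E →L[ℝ] ℝ) := fun s ↦ (g s).val x
  have hBc : Continuous B :=
    (h.continuousOn_val x).comp_continuous continuous_subtype_val fun s ↦ s.2
  let P : Set S := {s | ∀ w : E, w ≠ 0 → 0 < B s w w}
  have hopen : IsOpen P := by
    rw [isOpen_iff_mem_nhds]
    intro s hs
    obtain ⟨m, hm, hmle⟩ := exists_pos_mul_norm_sq_le_of_forall_pos (B s) hs
    have hBn : Continuous fun s' : S ↦ ‖B s' - B s‖ := (hBc.sub continuous_const).norm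
    have h0 : ‖B s - B s‖ < m := by simp [hm]
    have hev : ∀ᶠ s' in 𝓝 s, ‖B s' - B s‖ < m := hBn.continuousAt.eventually_lt_const h0
    refine mem_of_superset hev fun s' hs' w hw ↦ ?_
    exact forall_pos_of_norm_sub_lt hmle hs' w hw
  have hclosed : IsClosed P := by
    rw [← closure_subset_iff_isClosed]
    intro s hs w hw
    have hpsd : ∀ u : E, 0 ≤ B s u u := by
      intro u
      have e1 : Continuous fun C : E →L[ℝ] E →L[ℝ] ℝ ↦ C u := continuous_eval_const u
      have e2 : Continuous fun C : E →L[ℝ] ℝ ↦ C u := continuous_eval_const u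
      have hcu : Continuous fun s' : S ↦ B s' u u := e2.comp (e1.comp hBc)
      have hsub : P ⊆ {s' : S | 0 ≤ B s' u u} := by
        intro s' hs'
        rcases eq_or_ne u 0 with rfl | hu
        · simp
        · exact (hs' u hu).le
      exact closure_minimal hsub (isClosed_le continuous_const hcu) hs
    exact forall_pos_of_forall_nonneg_of_nondegenerate (B s) ((g s).symm x) ((g s).nondegenerate x)
      hpsd w hw
  have hP : P = univ := IsClopen.eq_univ ⟨hclosed, hopen⟩ ⟨⟨t₀, ht₀⟩, fun w hw ↦ h₀ x w hw⟩
  have hmem : (⟨t, ht⟩ : S) ∈ P := hP ▸ mem_univ _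
  exact hmem v hv

end Family

/-! ### Consequences for the Ricci flow -/

section RicciFlow

variable {E : Type*} [NormedAddCommGroup E] [NormedSpace ℝ E] {H : Type*} [TopologicalSpace H]
  {I : ModelWithCorners ℝ E H} {M : Type*} [TopologicalSpace M] [ChartedSpace H M]
  [IsManifold I ∞ M] [FiniteDimensional ℝ E] [CompleteSpace E]

/-- Along a Ricci flow on an interval of times containing `t₀`, if `g_{t₀}` is Riemannian then all
`g_t` are (`IsContMDiffFamilyOn.isRiemannian_of_mem` applied to `IsRicciFlow.smooth`).
[folklore] -/
theorem IsRicciFlow.isRiemannian_of_mem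
    {g : ℝ → PseudoRiemannianMetric I ∞ E (TangentSpace I : M → Type _)}
    {cov : ℝ → CovariantDerivative I E (TangentSpace I : M → Type _)} {S : Set ℝ}
    (h : IsRicciFlow g cov S) (hS : IsPreconnected S) {t₀ : ℝ} (ht₀ : t₀ ∈ S)
    (h₀ : (g t₀).IsRiemannian) : ∀ t ∈ S, (g t).IsRiemannian :=
  h.smooth.isRiemannian_of_mem hS ht₀ h₀

/-- **A Ricci-flat metric is a static Ricci flow**, unconditionally: for a `C^∞` metric `g₀`
with `Ric(g₀) = 0` (`IsRicciFlat`, with respect to its Levi-Civita connection `g₀.leviCivita`,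
which exists by `PseudoRiemannianMetric.hasLeviCivita` and is Levi-Civita by
`isLeviCivita_leviCivita_holds`), the constant family `t ↦ g₀` with connections `t ↦ g₀.leviCivita`
is a Ricci flow on every time set (Topping 2006, §1.2.1, the case `λ = 0` of
`g(t) = (1 - 2λt) g₀` for Einstein metrics). Declared by its absolute name as a dot-notation
extension of `PseudoRiemannianMetric.IsRicciFlat` (`Lorentzian/Einstein.lean`).
[cite: Topping2006, §1.2.1] -/
theorem _root_.Literature.Geometry.Lorentzian.PseudoRiemannianMetric.IsRicciFlat.isRicciFlow_const
    (g₀ : PseudoRiemannianMetric I ∞ E (TangentSpace I : M → Type _)) [g₀.HasLeviCivita]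
    (h : g₀.IsRicciFlat) (S : Set ℝ) :
    IsRicciFlow (fun _ : ℝ ↦ g₀) (fun _ : ℝ ↦ g₀.leviCivita) S :=
  isRicciFlow_const_of_ricci_eq_zero g₀ g₀.leviCivita
    ⟨(isLeviCivita_leviCivita_holds (g := g₀)).1, (isLeviCivita_leviCivita_holds (g := g₀)).2⟩
    (fun x ↦ h x) S

omit [IsManifold I ∞ M] [CompleteSpace E] in
/-- **In dimension `≤ 1` every covariant derivative on `TM` has vanishing Ricci tensor**: the
tangent space is spanned by one vector `v₁`, and `R(a v₁, b v₁) Y = ab R(v₁, v₁) Y = 0` by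
antisymmetry (`CovariantDerivative.curvature_self`), so `Ric(X, Y) = tr (v ↦ R(v, X) Y) = 0`.
[folklore] -/
theorem ricci_eq_zero_of_finrank_le_one [IsManifold I 2 M] (hE : Module.finrank ℝ E ≤ 1)
    (cov : CovariantDerivative I E (TangentSpace I : M → Type _)) (x : M) : cov.ricci x = 0 := by
  obtain ⟨v₁, hv₁⟩ := finrank_le_one_iff.1 hE
  have hT : ∀ w : TangentSpace I x, ∃ c : ℝ, c • (show TangentSpace I x from v₁) = w := hv₁
  have haux : ∀ X₀ Y₀ : TangentSpace I x, cov.ricciAux x X₀ Y₀ = 0 := by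
    intro X₀ Y₀
    ext v
    rw [CovariantDerivative.ricciAux_apply, LinearMap.zero_apply]
    obtain ⟨a, rfl⟩ := hT v
    obtain ⟨b, rfl⟩ := hT X₀
    simp
  ext X₀ Y₀
  rw [CovariantDerivative.ricci_apply, haux]
  simp

/-- **Short-time (indeed eternal) existence of the Ricci flow in dimension `≤ 1`**: there the
Levi-Civita connection of any `C^∞` metric `g₀` is Ricci-flat (`ricci_eq_zero_of_finrank_le_one`),
so the static family `t ↦ g₀` with `t ↦ g₀.leviCivita` is a Ricci flow of Riemannian metrics on
`[0, 1]` from `g₀` (on any manifold, compact or not). This is the conclusion of the named fact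
`ricciFlow_shortTime_existence` (Hamilton 1982, Thm. 4.2) in the trivial dimensions. [folklore] -/
theorem exists_isRicciFlow_of_finrank_le_one (hE : Module.finrank ℝ E ≤ 1)
    (g₀ : PseudoRiemannianMetric I ∞ E (TangentSpace I : M → Type _)) (hg₀ : g₀.IsRiemannian) :
    ∃ ε : ℝ, 0 < ε ∧
      ∃ (g : ℝ → PseudoRiemannianMetric I ∞ E (TangentSpace I : M → Type _))
        (cov : ℝ → CovariantDerivative I E (TangentSpace I : M → Type _)),
        IsRicciFlow g cov (Icc 0 ε) ∧ g 0 = g₀ ∧ ∀ t ∈ Icc 0 ε, (g t).IsRiemannian := by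
  haveI := g₀.hasLeviCivita
  refine ⟨1, one_pos, fun _ ↦ g₀, fun _ ↦ g₀.leviCivita, ?_, rfl, fun _ _ ↦ hg₀⟩
  exact isRicciFlow_const_of_ricci_eq_zero g₀ g₀.leviCivita
    ⟨(isLeviCivita_leviCivita_holds (g := g₀)).1, (isLeviCivita_leviCivita_holds (g := g₀)).2⟩
    (ricci_eq_zero_of_finrank_le_one hE g₀.leviCivita) _

/-- **Reduction of short-time existence to bare existence of a flow.** The named fact
`ricciFlow_shortTime_existence` (Hamilton 1982, Thm. 4.2; Topping 2006, Thm. 5.2.1) follows from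
the statement without its last clause: if every `C^∞` Riemannian metric `g₀` on a closed manifold
is the initial value of some Ricci flow `(g, cov)` on some `[0, ε]`, `ε > 0`, then the metrics
`g t`, `t ∈ [0, ε]`, are automatically Riemannian (`IsRicciFlow.isRiemannian_of_mem`: the
signature cannot change along a continuous family of nondegenerate metrics). [folklore] -/
theorem ricciFlow_shortTime_existence_of_forall_exists_isRicciFlow
    (hex : ∀ {E : Type u} [NormedAddCommGroup E] [NormedSpace ℝ E] [FiniteDimensional ℝ E]
      [CompleteSpace E] {H : Type v} [TopologicalSpace H] (I : ModelWithCorners ℝ E H)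
      [I.Boundaryless] (M : Type w) [TopologicalSpace M] [T2Space M] [SecondCountableTopology M]
      [CompactSpace M] [ChartedSpace H M] [IsManifold I ∞ M]
      (g₀ : PseudoRiemannianMetric I ∞ E (TangentSpace I : M → Type _)), g₀.IsRiemannian →
      ∃ ε : ℝ, 0 < ε ∧
        ∃ (g : ℝ → PseudoRiemannianMetric I ∞ E (TangentSpace I : M → Type _))
          (cov : ℝ → CovariantDerivative I E (TangentSpace I : M → Type _)),
          IsRicciFlow g cov (Icc 0 ε) ∧ g 0 = g₀) :
    ricciFlow_shortTime_existence.{u, v, w} := by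
  intro E _ _ _ _ H _ I _ M _ _ _ _ _ _ g₀ hg₀
  obtain ⟨ε, hε, g, cov, hflow, h0⟩ := hex I M g₀ hg₀
  refine ⟨ε, hε, g, cov, hflow, h0, ?_⟩
  have h0' : (g 0).IsRiemannian := by rw [h0]; exact hg₀
  exact hflow.isRiemannian_of_mem isPreconnected_Icc (left_mem_Icc.2 hε.le) h0'

end RicciFlow

end Literature.Geometry.Riemannian

end
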